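import Summits.Ventures.CertifiedManyBodySolver.Theorems.TcThermcert1SaddleBoxGaussian
import Mathlib
import HarnessLib

/-!
# Saddle box lower bound, part 2: the local box lower bound (K3a)

Helper file (part 2 of 2) for route `TcThermcert1`, crux `ThermalStiffnessCeilingU8b10_le_1o8`
(item `stmt-Ventures-26381`), line `Cruxes/ThermalStiffnessCeilingU8b10_le_1o8/Lines/zerofree_corridor.lean`,
registered stub `stub_largePowersSaddle2D`.  Line v8 (§L) splits that stub into (K3a) the LOCAL BOX LOWER
BOUND proved here and (K3b) the saddle geometry on the fugacity torus; this file is K3a (no model input).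

Statement (`box_integral_re_lower_bound`).  Given `0 < ρ`, `0 < s`, `0 < S`, `0 ≤ K` there are `τ₀ > 0`,
`c > 0` and `M₀` such that for every `M ≥ M₀` and every jointly continuous `G : ℝ → ℝ → ℂ` satisfying, on the
box `|u|, |v| ≤ ρ`, `−S (u²+v²) ≤ Re G ≤ −s (u²+v²)` and `|Im G| ≤ τ₀ (u²+v²) + K (|u|+|v|)³`, one has
`c / M ≤ Re ∫_{−ρ}^{ρ} ∫_{−ρ}^{ρ} exp (M · G u v) dv du`.

Proof.  On the centre square `|u|, |v| ≤ δ = V/√M` the phase `M · Im G` is at most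
`2 τ₀ V² + 8 K V³/√M ≤ 1`, so `Re exp (M G) ≥ ½ e^{−MS(u²+v²)}` (part 1, §2); off it
`|exp (M G)| ≤ e^{−Ms u²} e^{−Ms v²}`.  Part 1, §3 then gives
`Re ∫∫ ≥ B²/2 − 4 δ E − 2 J E ≥ 2 e^{−2S}/M − C e^{−sV²}/M ≥ e^{−2S}/M` for the absolute choice
`s V² = s + 2S + C`, `C = (√(π/s) + 2)/s` (using `C e^{−C} ≤ 1`).  Constants: `τ₀ = 1/(4V²)`,
`c = e^{−2S}`, `M₀ = ⌈V²/ρ²⌉₊ + ⌈256 K² V⁶⌉₊ + 1`.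

§5 adds the three model-free glue lemmas the line's composition K3a + K3b ⇒ K3 uses: `eventually_mul_exp_neg_lt_div`
(`A e^{−γM} < c/M` eventually), `sq_integral_periodic_recentre` (recentring a doubly periodic double integral at any
point, no integrability needed) and `sq_integral_ne_zero_of_box` (box lower bound + off-box smallness `8P²η < c'` ⇒ the
full-square integral is non-zero; a second five-piece split with `norm_integral_le_of_norm_le_const`).

[folklore] Laplace-method bookkeeping; constants not optimised.  No definitions; all statements proved;
no `sorry`.
-/

noncomputable section

open MeasureTheory Set

namespace Summit.Ventures.CertifiedManyBodySolver.Theorems.TcThermcert1.ZeroFreeCorridor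

/-! ## §4 The local box lower bound (K3a) -/

/-- **K3a — local box lower bound.**  Given `0 < ρ`, `0 < s`, `0 < S`, `0 ≤ K` there are `τ₀ > 0`, `c > 0` and
`M₀ : ℕ` such that for all `M ≥ M₀` and all jointly continuous `G : ℝ → ℝ → ℂ` with, on the box `|u|, |v| ≤ ρ`,
`Re G ≤ −s (u²+v²)`, `Re G ≥ −S (u²+v²)` and `|Im G| ≤ τ₀ (u²+v²) + K (|u|+|v|)³`, the double integral
`∫_{−ρ}^{ρ} ∫_{−ρ}^{ρ} exp (M · G u v) dv du` has real part `≥ c / M`.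
(Constants: `τ₀ = 1/(4V²)`, `c = e^{−2S}`, `M₀ = ⌈V²/ρ²⌉₊ + ⌈256 K² V⁶⌉₊ + 1` with `s V² = s + 2S + C`,
`C = (√(π/s) + 2)/s`.)  This is the model-free half of the hot-end saddle estimate `stub_largePowersSaddle2D`. -/
theorem box_integral_re_lower_bound {ρ s S K : ℝ} (hρ : 0 < ρ) (hs : 0 < s) (hS : 0 < S) (hK : 0 ≤ K) :
    ∃ τ₀ : ℝ, 0 < τ₀ ∧ ∃ c : ℝ, 0 < c ∧ ∃ M₀ : ℕ, ∀ M : ℕ, M₀ ≤ M →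
      ∀ G : ℝ → ℝ → ℂ, Continuous (Function.uncurry G) →
        (∀ u v : ℝ, |u| ≤ ρ → |v| ≤ ρ →
            (G u v).re ≤ -s * (u ^ 2 + v ^ 2) ∧ -S * (u ^ 2 + v ^ 2) ≤ (G u v).re ∧
              |(G u v).im| ≤ τ₀ * (u ^ 2 + v ^ 2) + K * (|u| + |v|) ^ 3) →
          c / M ≤ (∫ u in (-ρ)..ρ, ∫ v in (-ρ)..ρ, Complex.exp ((M : ℂ) * G u v)).re := by
  -- absolute constants `A = √(π/s)`, `C = (A+2)/s`, `V = √(1 + (2S+C)/s)`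
  obtain ⟨A, hA⟩ : ∃ A, Real.sqrt (Real.pi / s) = A := ⟨_, rfl⟩
  have hA0 : 0 ≤ A := hA ▸ Real.sqrt_nonneg _
  obtain ⟨C, hC⟩ : ∃ C, (A + 2) / s = C := ⟨_, rfl⟩
  have hC0 : 0 < C := by rw [← hC]; positivity
  have hCexp : C * Real.exp (-C) ≤ 1 := by
    have h1 : C ≤ Real.exp C := by linarith [Real.add_one_le_exp C]
    calc C * Real.exp (-C) ≤ Real.exp C * Real.exp (-C) :=
          mul_le_mul_of_nonneg_right h1 (Real.exp_pos _).le
      _ = 1 := by rw [← Real.exp_add]; simp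
  obtain ⟨V, hV⟩ : ∃ V, Real.sqrt (1 + (2 * S + C) / s) = V := ⟨_, rfl⟩
  have hV1 : 1 ≤ V := by
    rw [← hV, Real.one_le_sqrt]
    have : 0 ≤ (2 * S + C) / s := by positivity
    linarith
  have hV0 : 0 < V := one_pos.trans_le hV1
  have hsV : s * V ^ 2 = s + 2 * S + C := by
    rw [← hV, Real.sq_sqrt (by positivity), mul_add, mul_one, mul_div_cancel₀ _ hs.ne']
    ring
  refine ⟨1 / (4 * V ^ 2), by positivity, Real.exp (-2 * S), Real.exp_pos _,
    ⌈V ^ 2 / ρ ^ 2⌉₊ + ⌈256 * K ^ 2 * V ^ 6⌉₊ + 1, ?_⟩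
  intro M hM G hG hGb
  -- the size of `M`
  have hMV : V ^ 2 / ρ ^ 2 ≤ (M : ℝ) := by
    have h1 := Nat.le_ceil (V ^ 2 / ρ ^ 2)
    have h2 : (⌈V ^ 2 / ρ ^ 2⌉₊ : ℝ) ≤ M := by exact_mod_cast (by omega : ⌈V ^ 2 / ρ ^ 2⌉₊ ≤ M)
    linarith
  have hMK : 256 * K ^ 2 * V ^ 6 ≤ (M : ℝ) := by
    have h1 := Nat.le_ceil (256 * K ^ 2 * V ^ 6)
    have h2 : (⌈256 * K ^ 2 * V ^ 6⌉₊ : ℝ) ≤ M := by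
      exact_mod_cast (by omega : ⌈256 * K ^ 2 * V ^ 6⌉₊ ≤ M)
    linarith
  have hM0 : (0 : ℝ) < M := by
    have : (1 : ℝ) ≤ M := by exact_mod_cast (by omega : 1 ≤ M)
    linarith
  -- `n = √M`
  have hn0 : 0 < Real.sqrt M := Real.sqrt_pos.mpr hM0
  have hn2 : Real.sqrt M ^ 2 = (M : ℝ) := Real.sq_sqrt hM0.le
  have hn16 : 16 * K * V ^ 3 ≤ Real.sqrt M := by
    rw [Real.le_sqrt (by positivity) hM0.le]
    calc (16 * K * V ^ 3) ^ 2 = 256 * K ^ 2 * V ^ 6 := by ring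
      _ ≤ (M : ℝ) := hMK
  have hnV : V / ρ ≤ Real.sqrt M := by
    rw [Real.le_sqrt (by positivity) hM0.le, div_pow]
    exact hMV
  generalize hn : Real.sqrt (M : ℝ) = n at hn0 hn2 hn16 hnV
  -- the centre half-width `δ = V/n`
  obtain ⟨δ, hδ⟩ : ∃ δ, V / n = δ := ⟨_, rfl⟩
  have hδ0 : 0 < δ := by rw [← hδ]; positivity
  have hδn : δ * n = V := by rw [← hδ]; field_simp
  have hδρ : δ ≤ ρ := by
    rw [← hδ, div_le_iff₀ hn0]
    have := (div_le_iff₀ hρ).mp hnV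
    linarith
  have hnδ : 1 / n ≤ δ := by rw [← hδ]; exact div_le_div_of_nonneg_right hV1 hn0.le
  have hMδ : (M : ℝ) * δ = V * n := by rw [← hn2, ← hδn]; ring
  have hMδ2 : (M : ℝ) * δ ^ 2 = V ^ 2 := by rw [← hn2, ← hδn]; ring
  have hτ : 1 / (4 * V ^ 2) * (2 * ((M : ℝ) * δ ^ 2)) = 1 / 2 := by
    rw [hMδ2]
    field_simp
    ring
  have hK8 : 8 * K * ((M : ℝ) * δ ^ 3) ≤ 1 / 2 := by
    have h1 : (M : ℝ) * δ ^ 3 = V ^ 2 * δ := by rw [← hn2, ← hδn]; ring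
    have h2 : V ^ 2 * δ * n = V ^ 3 := by rw [← hδn]; ring
    rw [h1]
    have h3 : 8 * K * (V ^ 2 * δ) * n ≤ 1 / 2 * n := by
      calc 8 * K * (V ^ 2 * δ) * n = 8 * K * (V ^ 2 * δ * n) := by ring
        _ = 8 * K * V ^ 3 := by rw [h2]
        _ ≤ 1 / 2 * n := by linarith [hn16]
    exact le_of_mul_le_mul_right h3 hn0
  -- real and imaginary parts of `M · w`
  have hre : ∀ w : ℂ, ((M : ℂ) * w).re = (M : ℝ) * w.re := fun w => by simp [Complex.mul_re]
  have him : ∀ w : ℂ, ((M : ℂ) * w).im = (M : ℝ) * w.im := fun w => by simp [Complex.mul_im]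
  -- pointwise bound (1): modulus on the box
  have h1 : ∀ u v, |u| ≤ ρ → |v| ≤ ρ → ‖Complex.exp ((M : ℂ) * G u v)‖
      ≤ Real.exp (-((M : ℝ) * s) * u ^ 2) * Real.exp (-((M : ℝ) * s) * v ^ 2) := by
    intro u v hu hv
    rw [Complex.norm_exp, hre, ← Real.exp_add]
    apply Real.exp_le_exp.mpr
    have h := mul_le_mul_of_nonneg_left (hGb u v hu hv).1 hM0.le
    linarith
  -- pointwise bound (2): real part on the centre square
  have h2 : ∀ u v, |u| ≤ δ → |v| ≤ δ →
      Real.exp (-((M : ℝ) * S) * u ^ 2) * Real.exp (-((M : ℝ) * S) * v ^ 2) / 2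
        ≤ (Complex.exp ((M : ℂ) * G u v)).re := by
    intro u v hu hv
    obtain ⟨-, hlo, himb⟩ := hGb u v (hu.trans hδρ) (hv.trans hδρ)
    have hu2 : u ^ 2 ≤ δ ^ 2 := sq_le_sq' (abs_le.mp hu).1 (abs_le.mp hu).2
    have hv2 : v ^ 2 ≤ δ ^ 2 := sq_le_sq' (abs_le.mp hv).1 (abs_le.mp hv).2
    have huv3 : (|u| + |v|) ^ 3 ≤ (2 * δ) ^ 3 := pow_le_pow_left₀ (by positivity) (by linarith) 3
    have hI1 : |((M : ℂ) * G u v).im| ≤ 1 := by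
      rw [him, abs_mul, abs_of_pos hM0]
      calc (M : ℝ) * |(G u v).im|
          ≤ (M : ℝ) * (1 / (4 * V ^ 2) * (u ^ 2 + v ^ 2) + K * (|u| + |v|) ^ 3) :=
            mul_le_mul_of_nonneg_left himb hM0.le
        _ ≤ (M : ℝ) * (1 / (4 * V ^ 2) * (2 * δ ^ 2) + K * (2 * δ) ^ 3) := by
            apply mul_le_mul_of_nonneg_left _ hM0.le
            have ha : 1 / (4 * V ^ 2) * (u ^ 2 + v ^ 2) ≤ 1 / (4 * V ^ 2) * (2 * δ ^ 2) :=
              mul_le_mul_of_nonneg_left (by linarith) (by positivity)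
            have hb : K * (|u| + |v|) ^ 3 ≤ K * (2 * δ) ^ 3 := mul_le_mul_of_nonneg_left huv3 hK
            linarith
        _ = 1 / (4 * V ^ 2) * (2 * ((M : ℝ) * δ ^ 2)) + 8 * K * ((M : ℝ) * δ ^ 3) := by ring
        _ ≤ 1 / 2 + 1 / 2 := by rw [hτ]; linarith [hK8]
        _ = 1 := by norm_num
    have h := half_exp_re_le_re_cexp hI1
    rw [hre] at h
    refine le_trans ?_ h
    rw [← Real.exp_add]
    have h' := mul_le_mul_of_nonneg_left hlo hM0.le
    gcongr
    linarith
  -- the abstract box estimate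
  have hf : Continuous (Function.uncurry fun u v => Complex.exp ((M : ℂ) * G u v)) :=
    Complex.continuous_exp.comp (continuous_const.mul hG)
  have hp : 0 < (M : ℝ) * s := by positivity
  have hB : 2 * Real.exp (-S) / n ≤ ∫ v in (-δ)..δ, Real.exp (-((M : ℝ) * S) * v ^ 2) := by
    refine integral_exp_neg_mul_sq_centre_ge hn0 (by positivity) (le_of_eq ?_) hnδ
    rw [← hn2]
    field_simp
  refine le_trans ?_ (re_box_integral_ge hδ0 hδρ hp (fun u v => Complex.exp ((M : ℂ) * G u v)) hf h1 h2)
  -- bookkeeping: `E = e^{−sV²}/(2 s V n)`, `J = A/n`, `B ≥ 2 e^{−S}/n`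
  have hE : Real.exp (-((M : ℝ) * s) * δ ^ 2) / (2 * ((M : ℝ) * s) * δ)
      = Real.exp (-(s * V ^ 2)) / (2 * s * V * n) := by
    have ha : -((M : ℝ) * s) * δ ^ 2 = -(s * V ^ 2) := by rw [← hMδ2]; ring
    have hb : 2 * ((M : ℝ) * s) * δ = 2 * s * V * n := by
      calc 2 * ((M : ℝ) * s) * δ = 2 * s * ((M : ℝ) * δ) := by ring
        _ = 2 * s * V * n := by rw [hMδ]; ring
    rw [ha, hb]
  have hJ : Real.sqrt (Real.pi / ((M : ℝ) * s)) = A / n := by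
    rw [← hA, ← hn2, show Real.pi / (n ^ 2 * s) = Real.pi / s / n ^ 2 by rw [div_div, mul_comm],
      Real.sqrt_div' _ (by positivity), Real.sqrt_sq hn0.le]
  rw [hE, hJ]
  generalize hBdef : (∫ v in (-δ)..δ, Real.exp (-((M : ℝ) * S) * v ^ 2)) = B at hB ⊢
  rw [← hn2]
  have hX : C * Real.exp (-(s * V ^ 2)) ≤ Real.exp (-2 * S) := by
    have e1 : Real.exp (-(s * V ^ 2)) = Real.exp (-C) * (Real.exp (-s) * Real.exp (-2 * S)) := by
      rw [← Real.exp_add, ← Real.exp_add, hsV]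
      congr 1
      ring
    have e2 : Real.exp (-s) ≤ 1 := Real.exp_le_one_iff.mpr (by linarith)
    rw [e1]
    calc C * (Real.exp (-C) * (Real.exp (-s) * Real.exp (-2 * S)))
        = (C * Real.exp (-C)) * Real.exp (-s) * Real.exp (-2 * S) := by ring
      _ ≤ 1 * 1 * Real.exp (-2 * S) := by
          apply mul_le_mul_of_nonneg_right _ (Real.exp_pos _).le
          exact mul_le_mul hCexp e2 (Real.exp_pos _).le zero_le_one
      _ = Real.exp (-2 * S) := by ring
  have hX0 : 0 ≤ Real.exp (-(s * V ^ 2)) := (Real.exp_pos _).le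
  generalize hXdef : Real.exp (-(s * V ^ 2)) = X at hX hX0 ⊢
  generalize hYdef : Real.exp (-2 * S) = Y at hX ⊢
  have hB2 : 2 * (Y / n ^ 2) ≤ B ^ 2 / 2 := by
    have h0 : 0 ≤ 2 * Real.exp (-S) / n := by positivity
    have e1 : (2 * Real.exp (-S) / n) ^ 2 ≤ B ^ 2 := pow_le_pow_left₀ h0 hB 2
    have e2 : Real.exp (-S) ^ 2 = Y := by
      rw [← hYdef, sq, ← Real.exp_add]
      congr 1
      ring
    have e3 : (2 * Real.exp (-S) / n) ^ 2 = 4 * Y / n ^ 2 := by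
      rw [div_pow, mul_pow, e2]
      ring
    rw [e3] at e1
    have e4 : 2 * (Y / n ^ 2) = (4 * Y / n ^ 2) / 2 := by ring
    linarith
  have hT : 4 * δ * (X / (2 * s * V * n)) + 2 * (A / n) * (X / (2 * s * V * n)) ≤ Y / n ^ 2 := by
    rw [← hδ]
    have e1 : 4 * (V / n) * (X / (2 * s * V * n)) = (2 * X / s) / n ^ 2 := by
      field_simp
      ring
    have e2 : 2 * (A / n) * (X / (2 * s * V * n)) = (A * X / (s * V)) / n ^ 2 := by
      field_simp
    have e3 : A * X / (s * V) ≤ A * X / s :=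
      div_le_div_of_nonneg_left (by positivity) hs (le_mul_of_one_le_right hs.le hV1)
    rw [e1, e2, ← add_div]
    apply div_le_div_of_nonneg_right _ (by positivity)
    have e4 : 2 * X / s + A * X / s = C * X := by rw [← hC]; ring
    linarith
  linarith

/-! ## §5 From the box to the full period square (used by the composition `largePowersSaddle2D_of` of line v8 §L) -/

section BoxToSquare

open intervalIntegral Complex

/-- For `γ, c > 0` and `A ≥ 0`: `A e^{−γM} < c/M` for all large `M`. -/
theorem eventually_mul_exp_neg_lt_div {γ c A : ℝ} (hγ : 0 < γ) (hc : 0 < c) (hA : 0 ≤ A) :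
    ∃ M₂ : ℕ, ∀ M : ℕ, M₂ ≤ M → A * Real.exp (-γ * M) < c / M := by
  refine ⟨⌈2 * A / (γ ^ 2 * c)⌉₊ + 1, fun M hM => ?_⟩
  have hM0 : (0 : ℝ) < M := by exact_mod_cast (by omega : 0 < M)
  have hM1 : 2 * A / (γ ^ 2 * c) < M := by
    have h1 := Nat.le_ceil (2 * A / (γ ^ 2 * c))
    have h2 : ((⌈2 * A / (γ ^ 2 * c)⌉₊ : ℕ) : ℝ) + 1 ≤ M := by exact_mod_cast hM
    linarith
  have hexp : (γ * M) ^ 2 / 2 ≤ Real.exp (γ * M) := by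
    have := Real.pow_div_factorial_le_exp (x := γ * M) (by positivity) 2
    simpa [Nat.factorial] using this
  have hpos : 0 < (γ * M) ^ 2 / 2 := by positivity
  rw [show -γ * (M : ℝ) = -(γ * M) by ring, Real.exp_neg]
  have h3 : 2 * A < γ ^ 2 * c * M := by
    have := (div_lt_iff₀ (by positivity : 0 < γ ^ 2 * c)).mp hM1
    linarith
  have h4 : A * (Real.exp (γ * M))⁻¹ ≤ 2 * A / (γ ^ 2 * (M : ℝ) ^ 2) := by
    calc A * (Real.exp (γ * M))⁻¹ ≤ A * ((γ * M) ^ 2 / 2)⁻¹ :=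
          mul_le_mul_of_nonneg_left (inv_anti₀ hpos hexp) hA
      _ = 2 * A / (γ ^ 2 * (M : ℝ) ^ 2) := by rw [inv_div]; ring
  have h5 : 2 * A / (γ ^ 2 * (M : ℝ) ^ 2) < c / M := by
    rw [div_lt_div_iff₀ (by positivity) (by positivity)]
    nlinarith [mul_lt_mul_of_pos_right h3 hM0]
  exact h4.trans_lt h5

/-- Recentring a doubly `2P`-periodic integrand: `∫₀^{2P}∫₀^{2P} g = ∫_{-P}^{P}∫_{-P}^{P} g(φ₀+u, ψ₀+v)`
(no integrability needed). -/
theorem sq_integral_periodic_recentre {P : ℝ} (g : ℝ → ℝ → ℂ)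
    (h1 : ∀ φ, Function.Periodic (g φ) (2 * P)) (h2 : ∀ ψ, Function.Periodic (fun φ => g φ ψ) (2 * P))
    (φ₀ ψ₀ : ℝ) :
    ∫ φ in (0 : ℝ)..2 * P, ∫ ψ in (0 : ℝ)..2 * P, g φ ψ =
      ∫ u in (-P)..P, ∫ v in (-P)..P, g (φ₀ + u) (ψ₀ + v) := by
  have hin : ∀ φ, ∫ ψ in (0 : ℝ)..2 * P, g φ ψ = ∫ v in (-P)..P, g φ (ψ₀ + v) := by
    intro φ
    have h := (h1 φ).intervalIntegral_add_eq 0 (ψ₀ - P)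
    rw [zero_add, show ψ₀ - P + 2 * P = ψ₀ + P by ring] at h
    rw [h, intervalIntegral.integral_comp_add_left (g φ) ψ₀, show ψ₀ + -P = ψ₀ - P by ring]
  have hper : Function.Periodic (fun φ => ∫ v in (-P)..P, g φ (ψ₀ + v)) (2 * P) := by
    intro φ
    show (∫ v in (-P)..P, g (φ + 2 * P) (ψ₀ + v)) = ∫ v in (-P)..P, g φ (ψ₀ + v)
    exact intervalIntegral.integral_congr fun v _ => h2 (ψ₀ + v) φ
  simp_rw [hin]
  have h := hper.intervalIntegral_add_eq 0 (φ₀ - P)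
  rw [zero_add, show φ₀ - P + 2 * P = φ₀ + P by ring] at h
  rw [h, intervalIntegral.integral_comp_add_left (fun φ => ∫ v in (-P)..P, g φ (ψ₀ + v)) φ₀,
    show φ₀ + -P = φ₀ - P by ring]

/-- **From the box to the full square.** If a continuous `f` has real part of its box integral at least `c'`,
is bounded by `η` off the box `[-ρ,ρ]²` inside `[-P,P]²`, and `8P²η < c'`, then `∫_{-P}^{P}∫_{-P}^{P} f ≠ 0`. -/
theorem sq_integral_ne_zero_of_box {P ρ c' η : ℝ} (hρ : 0 < ρ) (hρP : ρ ≤ P) (hη : 0 ≤ η)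
    (f : ℝ → ℝ → ℂ) (hf : Continuous (Function.uncurry f))
    (hbox : c' ≤ (∫ u in (-ρ)..ρ, ∫ v in (-ρ)..ρ, f u v).re)
    (hoff : ∀ u v : ℝ, |u| ≤ P → |v| ≤ P → (ρ ≤ |u| ∨ ρ ≤ |v|) → ‖f u v‖ ≤ η)
    (hsmall : 8 * P ^ 2 * η < c') :
    (∫ u in (-P)..P, ∫ v in (-P)..P, f u v) ≠ 0 := by
  have hP : 0 < P := hρ.trans_le hρP
  have hfu : ∀ u, Continuous (f u) := fun u => hf.uncurry_left u
  have hfi : ∀ u a b, IntervalIntegrable (f u) volume a b := fun u a b => (hfu u).intervalIntegrable a b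
  have hIc : ∀ a b : ℝ, Continuous fun u => ∫ v in a..b, f u v := fun a b =>
    intervalIntegral.continuous_parametric_intervalIntegral_of_continuous' hf a b
  have hIi : ∀ a b c d : ℝ, IntervalIntegrable (fun u => ∫ v in a..b, f u v) volume c d :=
    fun a b c d => (hIc a b).intervalIntegrable c d
  have hRi : ∀ a b c d : ℝ, IntervalIntegrable (fun u => (∫ v in a..b, f u v).re) volume c d :=
    fun a b c d => (Complex.continuous_re.comp (hIc a b)).intervalIntegrable c d
  -- (i) outer strips `ρ ≤ |u| ≤ P`: the whole inner integral is small
  have hout : ∀ u, ρ ≤ |u| → |u| ≤ P → ‖∫ v in (-P)..P, f u v‖ ≤ η * (2 * P) := by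
    intro u hu huP
    have h := intervalIntegral.norm_integral_le_of_norm_le_const (a := -P) (b := P) (C := η)
      (f := f u) (fun v hv => ?_)
    · calc ‖∫ v in (-P)..P, f u v‖ ≤ η * |P - -P| := h
        _ = η * (2 * P) := by rw [show P - -P = 2 * P by ring, abs_of_pos (by positivity)]
    · rw [Set.uIoc_of_le (by linarith)] at hv
      exact hoff u v huP (abs_le.mpr ⟨hv.1.le, hv.2⟩) (Or.inl hu)
  have hT2 : ‖∫ u in ρ..P, ∫ v in (-P)..P, f u v‖ ≤ η * (2 * P) * P := by
    have h := intervalIntegral.norm_integral_le_of_norm_le_const (a := ρ) (b := P) (C := η * (2 * P))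
      (f := fun u => ∫ v in (-P)..P, f u v) (fun u hu => ?_)
    · calc ‖∫ u in ρ..P, ∫ v in (-P)..P, f u v‖ ≤ η * (2 * P) * |P - ρ| := h
        _ ≤ η * (2 * P) * P := by
          apply mul_le_mul_of_nonneg_left _ (by positivity)
          rw [abs_of_nonneg (by linarith)]; linarith
    · rw [Set.uIoc_of_le hρP] at hu
      have hu0 : 0 < u := hρ.trans hu.1
      exact hout u (by rw [abs_of_pos hu0]; exact hu.1.le) (by rw [abs_of_pos hu0]; exact hu.2)
  have hT1 : ‖∫ u in (-P)..(-ρ), ∫ v in (-P)..P, f u v‖ ≤ η * (2 * P) * P := by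
    have h := intervalIntegral.norm_integral_le_of_norm_le_const (a := -P) (b := -ρ) (C := η * (2 * P))
      (f := fun u => ∫ v in (-P)..P, f u v) (fun u hu => ?_)
    · calc ‖∫ u in (-P)..(-ρ), ∫ v in (-P)..P, f u v‖ ≤ η * (2 * P) * |-ρ - -P| := h
        _ ≤ η * (2 * P) * P := by
          apply mul_le_mul_of_nonneg_left _ (by positivity)
          rw [abs_of_nonneg (by linarith)]; linarith
    · rw [Set.uIoc_of_le (by linarith)] at hu
      have hu0 : u < 0 := by linarith [hu.2]
      exact hout u (by rw [abs_of_neg hu0]; linarith [hu.2]) (by rw [abs_of_neg hu0]; linarith [hu.1])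
  -- (ii) middle strip `|u| ≤ ρ`: inner integral = box part + two small side pieces
  have hmid : ∀ u, |u| ≤ ρ →
      (∫ v in (-ρ)..ρ, f u v).re - 2 * (η * P) ≤ (∫ v in (-P)..P, f u v).re := by
    intro u hu
    have huP : |u| ≤ P := hu.trans hρP
    have hs3 : ‖∫ v in ρ..P, f u v‖ ≤ η * P := by
      have h := intervalIntegral.norm_integral_le_of_norm_le_const (a := ρ) (b := P) (C := η) (f := f u)
        (fun v hv => ?_)
      · calc ‖∫ v in ρ..P, f u v‖ ≤ η * |P - ρ| := h
          _ ≤ η * P := mul_le_mul_of_nonneg_left (by rw [abs_of_nonneg (by linarith)]; linarith) hη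
      · rw [Set.uIoc_of_le hρP] at hv
        have hv0 : 0 < v := hρ.trans hv.1
        exact hoff u v huP (by rw [abs_of_pos hv0]; exact hv.2) (Or.inr (by rw [abs_of_pos hv0]; exact hv.1.le))
    have hs1 : ‖∫ v in (-P)..(-ρ), f u v‖ ≤ η * P := by
      have h := intervalIntegral.norm_integral_le_of_norm_le_const (a := -P) (b := -ρ) (C := η) (f := f u)
        (fun v hv => ?_)
      · calc ‖∫ v in (-P)..(-ρ), f u v‖ ≤ η * |-ρ - -P| := h
          _ ≤ η * P := mul_le_mul_of_nonneg_left (by rw [abs_of_nonneg (by linarith)]; linarith) hη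
      · rw [Set.uIoc_of_le (by linarith)] at hv
        have hv0 : v < 0 := by linarith [hv.2]
        exact hoff u v huP (by rw [abs_of_neg hv0]; linarith [hv.1])
          (Or.inr (by rw [abs_of_neg hv0]; linarith [hv.2]))
    have hsplit : ∫ v in (-P)..P, f u v =
        ((∫ v in (-P)..(-ρ), f u v) + ∫ v in (-ρ)..ρ, f u v) + ∫ v in ρ..P, f u v := by
      rw [intervalIntegral.integral_add_adjacent_intervals (hfi u _ _) (hfi u _ _),
        intervalIntegral.integral_add_adjacent_intervals (hfi u _ _) (hfi u _ _)]
    have r1 := abs_le.mp ((Complex.abs_re_le_norm _).trans hs1)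
    have r3 := abs_le.mp ((Complex.abs_re_le_norm _).trans hs3)
    rw [hsplit, Complex.add_re, Complex.add_re]
    linarith [r1.1, r3.1]
  have hMid : c' - 2 * (η * P) * (2 * ρ) ≤ (∫ u in (-ρ)..ρ, ∫ v in (-P)..P, f u v).re := by
    have hre : (∫ u in (-ρ)..ρ, ∫ v in (-P)..P, f u v).re = ∫ u in (-ρ)..ρ, (∫ v in (-P)..P, f u v).re := by
      have h := Complex.reCLM.intervalIntegral_comp_comm (hIi (-P) P (-ρ) ρ); simpa using h.symm
    have hre' : (∫ u in (-ρ)..ρ, ∫ v in (-ρ)..ρ, f u v).re = ∫ u in (-ρ)..ρ, (∫ v in (-ρ)..ρ, f u v).re := by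
      have h := Complex.reCLM.intervalIntegral_comp_comm (hIi (-ρ) ρ (-ρ) ρ); simpa using h.symm
    rw [hre]
    calc c' - 2 * (η * P) * (2 * ρ)
        ≤ (∫ u in (-ρ)..ρ, ∫ v in (-ρ)..ρ, f u v).re - 2 * (η * P) * (2 * ρ) := by linarith
      _ = ∫ u in (-ρ)..ρ, ((∫ v in (-ρ)..ρ, f u v).re - 2 * (η * P)) := by
          rw [intervalIntegral.integral_sub (hRi _ _ _ _) intervalIntegrable_const,
            intervalIntegral.integral_const, smul_eq_mul, hre']
          ring
      _ ≤ ∫ u in (-ρ)..ρ, (∫ v in (-P)..P, f u v).re :=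
          intervalIntegral.integral_mono_on (by linarith) ((hRi _ _ _ _).sub intervalIntegrable_const)
            (hRi _ _ _ _) (fun u hu => hmid u (abs_le.mpr ⟨hu.1, hu.2⟩))
  -- (iii) assemble
  have hsplit : ∫ u in (-P)..P, ∫ v in (-P)..P, f u v =
      ((∫ u in (-P)..(-ρ), ∫ v in (-P)..P, f u v) + ∫ u in (-ρ)..ρ, ∫ v in (-P)..P, f u v) +
        ∫ u in ρ..P, ∫ v in (-P)..P, f u v := by
    rw [intervalIntegral.integral_add_adjacent_intervals (hIi _ _ _ _) (hIi _ _ _ _),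
      intervalIntegral.integral_add_adjacent_intervals (hIi _ _ _ _) (hIi _ _ _ _)]
  have r1 := abs_le.mp ((Complex.abs_re_le_norm _).trans hT1)
  have r2 := abs_le.mp ((Complex.abs_re_le_norm _).trans hT2)
  have hηρ : η * P * ρ ≤ η * P * P := mul_le_mul_of_nonneg_left hρP (by positivity)
  have hpos : 0 < (∫ u in (-P)..P, ∫ v in (-P)..P, f u v).re := by
    rw [hsplit, Complex.add_re, Complex.add_re]
    nlinarith [r1.1, r2.1]
  intro h0
  rw [h0, Complex.zero_re] at hpos
  exact lt_irrefl _ hpos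

end BoxToSquare

end Summit.Ventures.CertifiedManyBodySolver.Theorems.TcThermcert1.ZeroFreeCorridor

end
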